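import Mathlib.MeasureTheory.Integral.Prod
import Mathlib.MeasureTheory.Group.Integral
import Mathlib.MeasureTheory.Function.L2Space
import Mathlib.Analysis.InnerProductSpace.Adjoint
import Mathlib.Topology.Algebra.ContinuousMonoidHom
import Literature.NumberTheory.Automorphic.HilbertRepSpectrum
import HarnessLib

/-!
# Gelfand's trick for orbital operators: `K`-averaged conjugates of a unitary representation commute

Topic `Literature/RepresentationTheory/CompactGroups`; namespace `Literature.RepresentationTheory.CompactGroups`.
Theorems and ONE auxiliary definition with body (`orbitalOp`); no named fact, no instance, no `sorry`.  GENERIC: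
any topological group `G`, any compact group `K` with a two-sided invariant, inversion invariant probability measure
`μ` and a continuous homomorphism `ι : K →* G`, any unitary strongly continuous representation `π` of `G` on a complex
Hilbert space `H`.

For `x ∈ G` the **orbital operator** is the `K`-average of the conjugates of `π x`,
`O_x v := ∫_K π (ι k · x · ι k⁻¹) v dμ(k)` (a Bochner integral of a continuous `H`-valued function on the compact
`K`; NO Haar measure on `G` is used).  These are the images of `π(G)` under the conditional expectation onto the
commutant of `π(ι K)`; they commute with `π (ι K)` (`apply_orbitalOp`), are stable under adjoints
(`adjoint_orbitalOp : O_x† = O_{x⁻¹}`) and multiply by the rule `O_x O_y = ∫_K O_{x · ιk y ιk⁻¹} dμ(k)`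
(`orbitalOp_orbitalOp_apply`, Fubini on `K × K`).

**Gelfand's trick** (`commute_orbitalOp_of_antiHom`).  Suppose `σ : G → G` is an anti-homomorphism
(`σ (a b) = σ b · σ a`), compatible with `K` through a continuous automorphism `θ` of `K` (`σ (ι k) = ι (θ k)⁻¹`,
`θ` preserving `μ`), and such that **every `σ z` is `ι(K)`-conjugate to `z`**.  Then all the `O_x` commute:
`O_x O_y = ∫ O_{x·Ad(ιk)y} = ∫ O_{σ(x·Ad(ιk)y)}` (conjugation invariance), and `σ` REVERSES the order of the
factors; the compatibility with `K` and the invariances of `μ` (two-sided, under `θ`, under inversion) turn the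
result into `∫ O_{y·Ad(ιk)x} = O_y O_x`.  This is the operator form of Gelfand's lemma on the commutativity of
convolution algebras of `K`-invariant functions (Helgason, *Groups and Geometric Analysis*, Ch. IV Thm. 3.1 for
`C_c(K\G/K)` under an involutive anti-automorphism with `σ g ∈ K g K`; here the `Ad K`-invariant version, i.e.
the Gelfand pair `(G × K, ΔK)`, written without Haar measure on `G`).  Its consumer is the multiplicity-one
theorem for `K`-types (`KTypeMultiplicityOneOfCommutingOrbital`) and, through it, Harish-Chandra's
admissibility theorem for `U(2,1)` with the transpose as `σ`.

* `orbitalOp μ ι π hι hπ hU x : H →L[ℂ] H` and `orbitalOp_apply`;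
* `apply_orbitalOp` (`π (ι u) ∘ O_x = O_x ∘ π (ι u)`), `orbitalOp_conj` (`O_{ιu x ιu⁻¹} = O_x`),
  `adjoint_orbitalOp` (`O_x† = O_{x⁻¹}`), `orbitalOp_orbitalOp_apply` (the product rule);
* (private) `map_inv_of_antiHom`, `antiHom_conj_formula` (bookkeeping for anti-homomorphisms);
* **`commute_orbitalOp_of_antiHom`** — Gelfand's trick.

## References
* S. Helgason, *Groups and Geometric Analysis*, Academic Press (1984) / AMS (2000), Ch. IV §3, Thm. 3.1 [Helgason2000].
* A. Deitmar, S. Echterhoff, *Principles of Harmonic Analysis*, 2nd ed. (2014), Lemma 6.1.7 (Schur), §7.3 [DeitmarEchterhoff2014].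

## Provenance
Cell `hodgecm-mathlib`, seat A-p14 (g27): road «T3 in-house via Gelfand's trick» (Harish-Chandra admissibility for
`U(2,1)`, block (H) of the closer `Cruxes/H413/Lines/F0_U3LettersRung1.lean`).  HC_CM is proved only modulo the
printed citations until rung 0 closes; this file is a generic leaf and changes no count.
-/

noncomputable section

open MeasureTheory ContinuousLinearMap ContRepresentation
open scoped InnerProductSpace

namespace Literature.RepresentationTheory.CompactGroups

variable {G : Type*} [Group G] [TopologicalSpace G] [IsTopologicalGroup G]
variable {K : Type*} [Group K] [TopologicalSpace K] [IsTopologicalGroup K] [CompactSpace K]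
  [MeasurableSpace K] [BorelSpace K]
variable (μ : Measure K) [IsProbabilityMeasure μ]
variable (ι : K →* G)
variable {H : Type*} [NormedAddCommGroup H] [InnerProductSpace ℂ H] [CompleteSpace H]
variable (π : ContRepresentation ℂ G H)

/-! ### The orbital operators -/

omit [TopologicalSpace G] [IsTopologicalGroup G] [CompleteSpace H] in
/-- `π (a b) v = π a (π b v)` (the representation is multiplicative; composition of bounded operators).
[folklore] -/
private theorem rep_mul_apply (a b : G) (v : H) : π (a * b) v = π a (π b v) := by
  rw [map_mul]; rfl

omit [IsTopologicalGroup K] [CompactSpace K] [MeasurableSpace K] [BorelSpace K] [CompleteSpace H] in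
/-- The conjugated orbit map `k ↦ π (ι k · x · ι k⁻¹) v` is continuous for a strongly continuous `π` and a
continuous `ι`. [cite: Helgason2000, Ch. IV §3 Thm. 3.1] -/
theorem continuous_repConjOrbit (hι : Continuous ι) (hπ : π.IsStronglyContinuous) (x : G) (v : H) :
    Continuous fun k : K => π (ι k * x * (ι k)⁻¹) v :=
  (hπ v).comp ((hι.mul continuous_const).mul hι.inv)

omit [IsTopologicalGroup K] [IsProbabilityMeasure μ] [CompleteSpace H] in
/-- The conjugated orbit map is integrable over the compact group `K`. [cite: Helgason2000, Ch. IV §3 Thm. 3.1] -/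
theorem integrable_repConjOrbit [IsFiniteMeasure μ] (hι : Continuous ι) (hπ : π.IsStronglyContinuous) (x : G)
    (v : H) : Integrable (fun k : K => π (ι k * x * (ι k)⁻¹) v) μ :=
  (continuous_repConjOrbit ι π hι hπ x v).integrable_of_hasCompactSupport (HasCompactSupport.of_compactSpace _)

omit [TopologicalSpace G] [IsTopologicalGroup G] [TopologicalSpace K] [IsTopologicalGroup K] [CompactSpace K]
  [BorelSpace K] in
/-- Norm bound for the orbital average of a unitary representation: `‖∫ π(ιk x ιk⁻¹) v‖ ≤ ‖v‖` (`μ` a probability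
measure). [cite: Helgason2000, Ch. IV §3 Thm. 3.1] -/
theorem norm_integral_repConjOrbit_le (hU : π.IsUnitary) (x : G) (v : H) :
    ‖∫ k, π (ι k * x * (ι k)⁻¹) v ∂μ‖ ≤ ‖v‖ := by
  have h := norm_integral_le_of_norm_le_const (μ := μ) (f := fun k : K => π (ι k * x * (ι k)⁻¹) v)
    (C := ‖v‖) (Filter.Eventually.of_forall fun k => (hU.norm_map _ v).le)
  simpa using h

/-- **The orbital operator** `O_x v = ∫_K π (ι k · x · ι k⁻¹) v dμ(k)` of a unitary strongly continuous
representation, as a bounded operator (`‖O_x‖ ≤ 1`).  (The value of the conditional expectation onto the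
commutant of `π(ιK)` at `π x`; Helgason Ch. IV §3: the `K`-average `f ↦ f♮`.) [cite: Helgason2000, Ch. IV §3 Thm. 3.1] -/
def orbitalOp (hι : Continuous ι) (hπ : π.IsStronglyContinuous) (hU : π.IsUnitary) (x : G) : H →L[ℂ] H :=
  LinearMap.mkContinuous
    { toFun := fun v => ∫ k, π (ι k * x * (ι k)⁻¹) v ∂μ
      map_add' := fun v w => by
        simp only [map_add]
        exact integral_add (integrable_repConjOrbit μ ι π hι hπ x v) (integrable_repConjOrbit μ ι π hι hπ x w)
      map_smul' := fun c v => by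
        simp only [map_smul, RingHom.id_apply]
        exact integral_smul c _ }
    1 fun v => by
      rw [one_mul]
      exact norm_integral_repConjOrbit_le μ ι π hU x v

variable {μ ι π}
variable {hι : Continuous ι} {hπ : π.IsStronglyContinuous} {hU : π.IsUnitary}

omit [IsTopologicalGroup K] in
/-- Unfolding `orbitalOp`. [cite: Helgason2000, Ch. IV §3 Thm. 3.1] -/
@[simp]
theorem orbitalOp_apply (x : G) (v : H) :
    orbitalOp μ ι π hι hπ hU x v = ∫ k, π (ι k * x * (ι k)⁻¹) v ∂μ := rfl

/-- **`O_x` commutes with `π (ι K)`**: `π (ι u) (O_x v) = O_x (π (ι u) v)` (left invariance of `μ`: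
`ιu · ιk x ιk⁻¹ = ι(uk) x ι(uk)⁻¹ · ιu`). [cite: Helgason2000, Ch. IV §3 Thm. 3.1] -/
theorem apply_orbitalOp [μ.IsMulLeftInvariant] (u : K) (x : G) (v : H) :
    π (ι u) (orbitalOp μ ι π hι hπ hU x v) = orbitalOp μ ι π hι hπ hU x (π (ι u) v) := by
  rw [orbitalOp_apply, orbitalOp_apply, ← (π (ι u)).integral_comp_comm (integrable_repConjOrbit μ ι π hι hπ x v)]
  have h := integral_mul_left_eq_self (μ := μ) (fun k : K => π (ι k * x * (ι k)⁻¹) (π (ι u) v)) u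
  rw [← h]
  refine integral_congr_ae (Filter.Eventually.of_forall fun k => ?_)
  have hg : ι u * (ι k * x * (ι k)⁻¹) = ι (u * k) * x * (ι (u * k))⁻¹ * ι u := by
    simp only [map_mul, mul_inv_rev]; group
  dsimp only
  rw [← rep_mul_apply, ← rep_mul_apply, hg]

/-- **Conjugation invariance**: `O_{ιu · x · ιu⁻¹} = O_x` (right invariance of `μ`). [cite: Helgason2000, Ch. IV §3 Thm. 3.1] -/
theorem orbitalOp_conj [μ.IsMulRightInvariant] (u : K) (x : G) :
    orbitalOp μ ι π hι hπ hU (ι u * x * (ι u)⁻¹) = orbitalOp μ ι π hι hπ hU x := by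
  ext v
  rw [orbitalOp_apply, orbitalOp_apply]
  have h := integral_mul_right_eq_self (μ := μ) (fun k : K => π (ι k * x * (ι k)⁻¹) v) u
  rw [← h]
  refine integral_congr_ae (Filter.Eventually.of_forall fun k => ?_)
  have hg : ι k * (ι u * x * (ι u)⁻¹) * (ι k)⁻¹ = ι (k * u) * x * (ι (k * u))⁻¹ := by
    simp only [map_mul, mul_inv_rev]; group
  dsimp only
  rw [hg]

omit [IsTopologicalGroup K] in
/-- **Adjoint**: `O_x† = O_{x⁻¹}` for unitary `π` (`π(g)† = π(g⁻¹)` and `(ιk x ιk⁻¹)⁻¹ = ιk x⁻¹ ιk⁻¹`).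
[cite: DeitmarEchterhoff2014, Lemma 6.1.7] -/
theorem adjoint_orbitalOp (x : G) :
    ContinuousLinearMap.adjoint (orbitalOp μ ι π hι hπ hU x) = orbitalOp μ ι π hι hπ hU x⁻¹ := by
  symm
  rw [ContinuousLinearMap.eq_adjoint_iff]
  intro v w
  rw [← inner_conj_symm, orbitalOp_apply, orbitalOp_apply,
    ← integral_inner (integrable_repConjOrbit μ ι π hι hπ x⁻¹ v),
    ← integral_inner (integrable_repConjOrbit μ ι π hι hπ x w), ← integral_conj]
  refine integral_congr_ae (Filter.Eventually.of_forall fun k => ?_)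
  have hinv : ι k * x⁻¹ * (ι k)⁻¹ = (ι k * x * (ι k)⁻¹)⁻¹ := by group
  dsimp only
  rw [inner_conj_symm, hinv, ← hU.adjoint_apply, ContinuousLinearMap.adjoint_inner_left]

omit [IsTopologicalGroup K] [CompactSpace K] [MeasurableSpace K] [BorelSpace K] [CompleteSpace H] in
/-- Joint continuity on `K × K` of `(k, k') ↦ π (ιk · (x · ιk' y ιk'⁻¹) · ιk⁻¹) v`. [cite: Helgason2000, Ch. IV §3 Thm. 3.1] -/
theorem continuous_repConjOrbit₂ (hι : Continuous ι) (hπ : π.IsStronglyContinuous) (x y : G) (v : H) :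
    Continuous fun p : K × K => π (ι p.1 * (x * (ι p.2 * y * (ι p.2)⁻¹)) * (ι p.1)⁻¹) v := by
  have h1 : Continuous fun p : K × K => ι p.1 := hι.comp continuous_fst
  have h2 : Continuous fun p : K × K => ι p.2 := hι.comp continuous_snd
  exact (hπ v).comp ((h1.mul (continuous_const.mul ((h2.mul continuous_const).mul h2.inv))).mul h1.inv)

/-- **Product rule**: `O_x (O_y v) = ∫_K O_{x · ιk y ιk⁻¹} v dμ(k)` (push `π(ιk x ιk⁻¹)` through the inner
integral, substitute `k' ↦ k k'` by left invariance, and swap the integrals by Fubini on the compact `K × K`).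
[cite: Helgason2000, Ch. IV §3 Thm. 3.1] -/
theorem orbitalOp_orbitalOp_apply [SecondCountableTopology K] [μ.IsMulLeftInvariant] (x y : G) (v : H) :
    orbitalOp μ ι π hι hπ hU x (orbitalOp μ ι π hι hπ hU y v) =
      ∫ k, orbitalOp μ ι π hι hπ hU (x * (ι k * y * (ι k)⁻¹)) v ∂μ := by
  simp only [orbitalOp_apply]
  -- push the outer operator through the inner integral
  have h1 : (fun k : K => π (ι k * x * (ι k)⁻¹) (∫ k', π (ι k' * y * (ι k')⁻¹) v ∂μ)) =
      fun k : K => ∫ k', π (ι k * x * (ι k)⁻¹ * (ι k' * y * (ι k')⁻¹)) v ∂μ := by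
    funext k
    rw [← (π (ι k * x * (ι k)⁻¹)).integral_comp_comm (integrable_repConjOrbit μ ι π hι hπ y v)]
    simp only [← rep_mul_apply]
  rw [h1]
  -- substitute `k' ↦ k k'` in the inner integral
  have h2 : (fun k : K => ∫ k', π (ι k * x * (ι k)⁻¹ * (ι k' * y * (ι k')⁻¹)) v ∂μ) =
      fun k : K => ∫ k', π (ι k * (x * (ι k' * y * (ι k')⁻¹)) * (ι k)⁻¹) v ∂μ := by
    funext k
    rw [← integral_mul_left_eq_self (μ := μ) _ k]
    refine integral_congr_ae (Filter.Eventually.of_forall fun k' => ?_)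
    have hg : ι k * x * (ι k)⁻¹ * (ι (k * k') * y * (ι (k * k'))⁻¹) =
        ι k * (x * (ι k' * y * (ι k')⁻¹)) * (ι k)⁻¹ := by
      simp only [map_mul, mul_inv_rev]; group
    dsimp only
    rw [hg]
  rw [h2]
  -- swap the two integrals
  have hint : Integrable (Function.uncurry fun k k' : K =>
      π (ι k * (x * (ι k' * y * (ι k')⁻¹)) * (ι k)⁻¹) v) (μ.prod μ) :=
    (continuous_repConjOrbit₂ hι hπ x y v).integrable_of_hasCompactSupport (HasCompactSupport.of_compactSpace _)
  exact integral_integral_swap hint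

/-! ### Anti-homomorphisms -/

omit [TopologicalSpace G] [IsTopologicalGroup G] in
/-- An anti-homomorphism of a group fixes `1`. [folklore] -/
private theorem map_one_of_antiHom {σ : G → G} (hσ : ∀ a b, σ (a * b) = σ b * σ a) : σ 1 = 1 := by
  have h := hσ 1 1
  rw [mul_one] at h
  exact mul_right_cancel (h.symm.trans (one_mul _).symm)

omit [TopologicalSpace G] [IsTopologicalGroup G] in
/-- An anti-homomorphism of a group commutes with inversion. [folklore] -/
private theorem map_inv_of_antiHom {σ : G → G} (hσ : ∀ a b, σ (a * b) = σ b * σ a) (g : G) : σ g⁻¹ = (σ g)⁻¹ := by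
  apply eq_inv_of_mul_eq_one_left
  rw [← hσ, mul_inv_cancel, map_one_of_antiHom hσ]

omit [TopologicalSpace G] [IsTopologicalGroup G] [TopologicalSpace K] [IsTopologicalGroup K] [CompactSpace K]
  [MeasurableSpace K] [BorelSpace K] in
/-- The image of `x · Ad(ιk) y` under a `K`-compatible anti-homomorphism: `σ (x · ιk y ιk⁻¹) = ι(θk) · σ y ·
ι(θk)⁻¹ · σ x`. [folklore] -/
private theorem antiHom_conj_formula {σ : G → G} (hσ : ∀ a b, σ (a * b) = σ b * σ a) (θ : K → K)
    (hσι : ∀ k, σ (ι k) = (ι (θ k))⁻¹) (x y : G) (k : K) :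
    σ (x * (ι k * y * (ι k)⁻¹)) = ι (θ k) * σ y * (ι (θ k))⁻¹ * σ x := by
  rw [hσ, hσ, hσ, map_inv_of_antiHom hσ, hσι, inv_inv]
  simp only [mul_assoc]

/-! ### Gelfand's trick -/

/-- **Gelfand's trick (orbital-operator form).**  Let `σ : G → G` be an anti-homomorphism, `θ` a continuous
automorphism of `K` preserving `μ` with `σ (ι k) = ι (θ k)⁻¹`, and suppose every `σ z` is `ι(K)`-conjugate to
`z`.  Then the orbital operators of a unitary strongly continuous representation pairwise commute:
`O_x O_y = O_y O_x`.  (Helgason Ch. IV Thm. 3.1: an involutive anti-automorphism with `σ g ∈ K g K` makes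
`C_c(K\G/K)` commutative; this is the `Ad K`-invariant version — the Gelfand pair `(G × K, ΔK)` — at the level of
a single unitary representation, with `μ` two-sided and inversion invariant.) [cite: Helgason2000, Ch. IV §3 Thm. 3.1] -/
theorem commute_orbitalOp_of_antiHom [SecondCountableTopology K] [μ.IsMulLeftInvariant] [μ.IsMulRightInvariant]
    [μ.IsInvInvariant]
    {σ : G → G} (hσ : ∀ a b, σ (a * b) = σ b * σ a) (θ : K ≃ₜ* K)
    (hθ : MeasurePreserving θ μ μ) (hσι : ∀ k, σ (ι k) = (ι (θ k))⁻¹)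
    (hconj : ∀ z : G, ∃ u : K, σ z = ι u * z * (ι u)⁻¹) (x y : G) :
    Commute (orbitalOp μ ι π hι hπ hU x) (orbitalOp μ ι π hι hπ hU y) := by
  obtain ⟨ux, hux⟩ := hconj x
  obtain ⟨uy, huy⟩ := hconj y
  -- abbreviation for the orbital operators
  set O : G → H →L[ℂ] H := orbitalOp μ ι π hι hπ hU with hO
  -- step 1: `O_{σ z} = O_z` for every `z`
  have hOσ : ∀ z : G, O (σ z) = O z := fun z => by
    obtain ⟨u, hu⟩ := hconj z
    rw [hu, hO, orbitalOp_conj]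
  ext v
  change O x (O y v) = O y (O x v)
  rw [hO, orbitalOp_orbitalOp_apply, orbitalOp_orbitalOp_apply, ← hO]
  -- step 2: rewrite the integrand of the left-hand side through `σ`
  have h2 : (fun k : K => O (x * (ι k * y * (ι k)⁻¹)) v) =
      fun k : K => O (ι (ux⁻¹ * θ k * uy) * y * (ι (ux⁻¹ * θ k * uy))⁻¹ * x) v := by
    funext k
    rw [← hOσ, antiHom_conj_formula hσ θ hσι, hux, huy]
    -- conjugate by `ι ux⁻¹`
    rw [hO, ← orbitalOp_conj (μ := μ) (hι := hι) (hπ := hπ) (hU := hU) ux⁻¹]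
    congr 1
    simp only [map_mul, map_inv, mul_inv_rev, inv_inv]
    group
  rw [h2]
  -- step 3: invariance of `μ` under `θ`, then under `k ↦ ux⁻¹ k` and `k ↦ k uy`
  have h3 : ∫ k, O (ι (ux⁻¹ * θ k * uy) * y * (ι (ux⁻¹ * θ k * uy))⁻¹ * x) v ∂μ =
      ∫ k, O (ι k * y * (ι k)⁻¹ * x) v ∂μ := by
    have hθ' := hθ.integral_comp θ.toHomeomorph.measurableEmbedding
      (fun k : K => O (ι (ux⁻¹ * k * uy) * y * (ι (ux⁻¹ * k * uy))⁻¹ * x) v)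
    erw [hθ']
    have hl := integral_mul_left_eq_self (μ := μ)
      (fun k : K => O (ι (k * uy) * y * (ι (k * uy))⁻¹ * x) v) ux⁻¹
    rw [hl]
    exact integral_mul_right_eq_self (μ := μ) (fun k : K => O (ι k * y * (ι k)⁻¹ * x) v) uy
  rw [h3]
  -- step 4: `O_{ιk y ιk⁻¹ x} = O_{y ιk⁻¹ x ιk}` (conjugate by `ιk⁻¹`), then inversion invariance
  have h4 : (fun k : K => O (ι k * y * (ι k)⁻¹ * x) v) =
      fun k : K => O (y * (ι k⁻¹ * x * (ι k⁻¹)⁻¹)) v := by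
    funext k
    rw [hO, ← orbitalOp_conj (μ := μ) (hι := hι) (hπ := hπ) (hU := hU) k⁻¹ (ι k * y * (ι k)⁻¹ * x)]
    congr 1
    simp only [map_inv, inv_inv]
    group
  rw [h4]
  exact integral_inv_eq_self (fun k : K => O (y * (ι k * x * (ι k)⁻¹)) v) μ

end Literature.RepresentationTheory.CompactGroups

end
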